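import Literature.NumberTheory.LocalFields.UnramifiedQuadraticNormFibres
import Mathlib.GroupTheory.Index
import HarnessLib

/-!
# The unit index of the orders `R_E(j) = R + π^j R_E` in an unramified quadratic extension: `[R_E^× : R_E(j)^×] = (1 + q⁻¹) q^j`
# (Flicker 1998, Prop. 7 and the REMARK p. 84; the `j`-weights `w(j)` of Cor. 9) — FILE 3 of the `UnramifiedQuadraticNorm` story

Topic `NumberTheory/LocalFields`, namespace `Literature.NumberTheory.LocalFields.UnramifiedQuadraticNorm` (as ★ FILES 1–2
`UnramifiedQuadraticNormFixedPoints` ∕ `UnramifiedQuadraticNormFibres`).  THEOREMS ONLY: no definition, no named fact, no instance, no notation,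
no `sorry`.  Cell `pub/hodgecm-mathlib`, F0∕P3a road «D-N7-inert», MAP v3 §2 brick **(F3a)** = [Flicker1998UnitaryFL, Prop. 7 p. 84] (the ORDER
INDICES feeding Prop. 6's torus decomposition of `H = U(1,1) × U(1)` and the weights `w(0) = 1`, `w(j) = (1 + q⁻¹) q^j` of Cor. 9 ∕ Props. 10–14),
LEAD F0P3a-plan (g9) WORD T8-46, census `F0/P2/F0P2-p06/g5/CENSUS-F3-HDecompositionsOrderIndices.F0P2p06g5.md`.  HC_CM is proved only modulo the
printed citations until rung 0 closes; nothing printed is a letter here — this is elementary finite counting.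

SETTING (as FILES 1–2).  `R` a discrete valuation ring with FINITE residue field `𝓀`, `|𝓀| = q²`; `σ` a ring involution of `R` (`σ ∘ σ = id`) moving
some element by a unit (`σ a − a ∈ Rˣ`).  Model: `R = R_E = 𝒪_w`, `σ = σ_w` at a non-split unramified place `w ∣ v` of a CM field, `R^σ = 𝒪_v`
(Flicker's `R`), `q = |𝓀_v|`.

THE σ-INTRINSIC READING OF FLICKER'S ORDERS (§1).  Writing `x = u + v·a` with `u, v ∈ R^σ` (FILE 1 §2), `σ x − x = v (σ a − a)` with `σ a − a` a unit,
so `R^σ + 𝔪^j = {x ∈ R : σ x − x ∈ 𝔪^j}` (**`map_sub_self_mem_pow_iff_exists_fixed`**); in the model `R^σ + 𝔪^j = 𝒪_v + ϖ^j 𝒪_w = R_E(j)` is exactly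
Flicker's order (`𝔪_w^j = ϖ_v^j 𝒪_w`, `E∕F` unramified).  Hence the unit group `R_E(j)^× = {u ∈ Rˣ : σ u − u ∈ 𝔪^j}` is the PREIMAGE, under the
reduction `Rˣ → (R ⧸ 𝔪^j)ˣ` (onto, §2), of the subgroup of `σ̄_j`-FIXED units (**`mem_comap_eqLocus_iff`**), and Prop. 7 is a quotient of two counts.

* §2 UNITS: `x mod 𝔪^k` is a unit iff `x` is (`k ≥ 1`, **`isUnit_mk_maximalIdeal_pow_iff`**); `Units.map (mk 𝔪^k)` is onto (**`units_map_mk_pow_surjective`**);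
  **`natCard_units_quotient_pow`**: `|(R ⧸ 𝔪^k)ˣ| = (q²)^{k−1} (q² − 1)` (FILE 2 §4) — this is also Flicker's `[R_E^× : 1 + π^m R_E] = (q² − 1) q^{2(m−1)}`
  of Prop. 8 p. 85; **`natCard_fixed_units_quotient_pow`**: `|σ̄_k-fixed units| = q^{k−1} (q − 1)` (FILE 1 `|Fix| = q^k` minus FILE 2's fixed non-units).
* §3 **PROP. 7**: **`index_comap_eqLocus_eq`** — for `j ≥ 1` the subgroup `{u ∈ Rˣ : σ u − u ∈ 𝔪^j}` has index `q^{j−1} (q + 1)` in `Rˣ`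
  (`= |units| ∕ |fixed units| = (q²)^{j−1}(q²−1) ∕ (q^{j−1}(q−1))`); `j = 0`: index `1` (**`index_comap_eqLocus_zero`**); the rational form
  **`index_comap_eqLocus_eq_rat`**: `index = (1 + q⁻¹) q^j` (the printed shape, = A-p03 (g24)'s weight `w j`); and Prop. 8's printed value
  **`flicker_prop8_value`**: `(q² − 1) q^{2(m−1)} · q^{2m} = (1 − q⁻²) q^{4m}` in `ℚ`.

## References
* [Flicker1998UnitaryFL] Y. Z. Flicker, *Elementary proof of the fundamental lemma for a unitary group*, Canad. J. Math. 50 (1998) 74–98, Prop. 7 and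
  REMARK p. 84 (letter of J. G. M. Mars), Prop. 8 pp. 84–85, Cor. 9 p. 85.
* [Serre1979] J.-P. Serre, *Local Fields*, GTM 67 (1979), Ch. IV §2 Prop. 6, Ch. V §2 Prop. 2–3.
-/

set_option autoImplicit false

namespace Literature.NumberTheory.LocalFields.UnramifiedQuadraticNorm

open Literature.NumberTheory.GaloisRepresentations IsLocalRing

universe u

variable {R : Type u} [CommRing R] (σ : R →+* R)

/-! ## §1 The order `R^σ + 𝔪^j` is `{x : σ x − x ∈ 𝔪^j}` -/

section Order

variable [IsLocalRing R] (hσ : ∀ a, σ (σ a) = a) {a : R} (ha : IsUnit (σ a - a))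

include hσ ha in
/-- **`R^σ + 𝔪^j = {x : σ x − x ∈ 𝔪^j}`**: `x` is congruent modulo `𝔪^j` to a `σ`-FIXED element iff `σ x ≡ x (mod 𝔪^j)` (FILE 1's σ-fixed lifts
`exists_fixed_sub_mem`; conversely `σ(𝔪^j) ⊆ 𝔪^j`).  In the model `R = 𝒪_w`, `R^σ = 𝒪_v`, `𝔪^j = ϖ_v^j 𝒪_w` this set is Flicker's order
`R_E(j) = R + π^j R_E`. [cite: Flicker1998UnitaryFL, REMARK p. 84] -/
theorem map_sub_self_mem_pow_iff_exists_fixed (j : ℕ) (x : R) :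
    σ x - x ∈ maximalIdeal R ^ j ↔ ∃ r : R, σ r = r ∧ x - r ∈ maximalIdeal R ^ j := by
  refine ⟨fun hx => ?_, ?_⟩
  · obtain ⟨r, hr, hrx⟩ := exists_fixed_sub_mem σ hσ ha hx
    refine ⟨r, hr, ?_⟩
    rw [← neg_sub]; exact (maximalIdeal R ^ j).neg_mem hrx
  · rintro ⟨r, hr, hxr⟩
    have h1 : σ (x - r) - (x - r) ∈ maximalIdeal R ^ j :=
      (maximalIdeal R ^ j).sub_mem (map_mem_maximalIdeal_pow σ hσ j _ hxr) hxr
    rwa [map_sub, hr, sub_sub_sub_cancel_right] at h1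

include hσ in
/-- The set `{x : σ x − x ∈ 𝔪^j}` is closed under multiplication (it is the subring `R^σ + 𝔪^j`):
`σ(xy) − xy = (σ x − x) σ y + x (σ y − y)`. [cite: Flicker1998UnitaryFL, REMARK p. 84] -/
theorem map_sub_self_mem_pow_mul (j : ℕ) {x y : R} (hx : σ x - x ∈ maximalIdeal R ^ j) (hy : σ y - y ∈ maximalIdeal R ^ j) :
    σ (x * y) - x * y ∈ maximalIdeal R ^ j := by
  have _ := hσ
  have e : σ (x * y) - x * y = (σ x - x) * σ y + x * (σ y - y) := by rw [map_mul]; ring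
  rw [e]
  exact (maximalIdeal R ^ j).add_mem ((maximalIdeal R ^ j).mul_mem_right _ hx) ((maximalIdeal R ^ j).mul_mem_left _ hy)

end Order

/-! ## §2 Units of `R ⧸ 𝔪^k`: lifting, and the two counts -/

section Units

variable [IsDomain R] [IsDiscreteValuationRing R]

/-- For `k ≥ 1`, `x mod 𝔪^k` is a unit iff `x` is (a local ring: `x y ≡ 1 (𝔪)` forces `x ∉ 𝔪`). [cite: Serre1979, Ch. IV §2 Prop. 6] -/
theorem isUnit_mk_maximalIdeal_pow_iff {k : ℕ} (hk : 1 ≤ k) (x : R) :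
    IsUnit (Ideal.Quotient.mk (maximalIdeal R ^ k) x) ↔ IsUnit x := by
  refine ⟨fun h => ?_, fun h => h.map _⟩
  obtain ⟨y, hy⟩ := h.exists_right_inv
  obtain ⟨y, rfl⟩ := Ideal.Quotient.mk_surjective y
  rw [← map_mul, ← (Ideal.Quotient.mk (maximalIdeal R ^ k)).map_one, Ideal.Quotient.eq] at hy
  have hxy : x * y - 1 ∈ maximalIdeal R := Ideal.pow_le_self (Nat.one_le_iff_ne_zero.1 hk) hy
  by_contra hx
  have hxm : x * y ∈ maximalIdeal R := (maximalIdeal R).mul_mem_right y ((mem_maximalIdeal _).2 (mem_nonunits_iff.2 hx))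
  have h1 : (1 : R) ∈ maximalIdeal R := by
    have := (maximalIdeal R).sub_mem hxm hxy
    rwa [sub_sub_cancel] at this
  exact (maximalIdeal.isMaximal R).ne_top ((Ideal.eq_top_iff_one _).2 h1)

/-- The reduction `Rˣ → (R ⧸ 𝔪^k)ˣ` is ONTO (`k ≥ 1`; every unit class has a unit representative). [cite: Serre1979, Ch. IV §2 Prop. 6] -/
theorem units_map_mk_pow_surjective {k : ℕ} (hk : 1 ≤ k) :
    Function.Surjective (Units.map (Ideal.Quotient.mk (maximalIdeal R ^ k)).toMonoidHom) := by
  intro u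
  obtain ⟨x, hx⟩ := Ideal.Quotient.mk_surjective (u : R ⧸ maximalIdeal R ^ k)
  have hxu : IsUnit x := (isUnit_mk_maximalIdeal_pow_iff hk x).1 (by rw [hx]; exact u.isUnit)
  refine ⟨hxu.unit, Units.ext ?_⟩
  rw [Units.coe_map, hxu.unit_spec]
  exact hx

/-- `|Mˣ| = |{x : M // IsUnit x}|`. [folklore] -/
private theorem natCard_units_eq_natCard_isUnit' (M : Type*) [Monoid M] : Nat.card Mˣ = Nat.card {x : M // IsUnit x} :=
  Nat.card_eq_of_bijective (fun u : Mˣ => (⟨(u : M), u.isUnit⟩ : {x : M // IsUnit x}))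
    ⟨fun _ _ h => Units.ext (congrArg Subtype.val h), fun x => ⟨x.2.unit, Subtype.ext x.2.unit_spec⟩⟩

variable [Finite (ResidueField R)] {q : ℕ} (hq : Nat.card (ResidueField R) = q ^ 2)

include hq in
/-- `2 ≤ q` when `|𝓀| = q²`. [folklore] -/
private theorem two_le_q : 2 ≤ q := by
  have h1 : 1 < Nat.card (ResidueField R) := Finite.one_lt_card_iff_nontrivial.2 inferInstance
  rw [hq] at h1
  by_contra hlt
  interval_cases q <;> simp at h1

include hq in
/-- **`|(R ⧸ 𝔪^k)ˣ| = (q²)^{k−1} (q² − 1)`** for `k ≥ 1` and `|𝓀| = q²` (FILE 2 §4: `|units| + |𝓀|^{k−1} = |𝓀|^k`).  In Flicker's notation this is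
`[R_E^× : 1 + π^k R_E] = (q² − 1) q^{2(k−1)}` (proof of Prop. 7; first factor of Prop. 8's `[P_H : P_H ∩ H^K_m]`).
[cite: Flicker1998UnitaryFL, Prop. 7 proof p. 84; Prop. 8 proof p. 85] [cite: Serre1979, Ch. IV §2 Prop. 6] -/
theorem natCard_units_quotient_pow {k : ℕ} (hk : 1 ≤ k) :
    Nat.card (R ⧸ maximalIdeal R ^ k)ˣ = (q ^ 2) ^ (k - 1) * (q ^ 2 - 1) := by
  have hU : Nat.card (R ⧸ maximalIdeal R ^ k)ˣ + (q ^ 2) ^ (k - 1) = (q ^ 2) ^ k := by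
    rw [natCard_units_eq_natCard_isUnit', ← hq]; exact natCard_isUnit_quotient_pow_add hk
  obtain ⟨j, rfl⟩ := Nat.exists_eq_add_of_le' hk
  rw [Nat.add_sub_cancel] at hU ⊢
  have h2 := two_le_q (R := R) hq
  have hq1 : 1 ≤ q ^ 2 := Nat.one_le_pow _ _ (by omega)
  have e : (q ^ 2) ^ (j + 1) = (q ^ 2) ^ j * (q ^ 2 - 1) + (q ^ 2) ^ j := by
    rw [pow_succ, Nat.mul_sub_one, Nat.sub_add_cancel (Nat.le_mul_of_pos_right _ (by omega))]
  rw [e] at hU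
  exact Nat.add_right_cancel hU

variable (hσ : ∀ a, σ (σ a) = a) {a : R} (ha : IsUnit (σ a - a))

include hσ ha hq in
/-- **`|σ̄_k-fixed UNITS of R ⧸ 𝔪^k| = q^{k−1} (q − 1)`** (`k ≥ 1`): `|Fix(σ̄_k)| = q^k` (FILE 1) minus the `q^{k−1}` fixed non-units (FILE 2).  In Flicker's
notation `[R^× : 1 + π^k R] = (q − 1) q^{k−1}` (`R = R_E^σ`). [cite: Flicker1998UnitaryFL, Prop. 7 proof p. 84] [cite: Serre1979, Ch. V §2 Prop. 2–3] -/
theorem natCard_fixed_units_quotient_pow {k : ℕ} (hk : 1 ≤ k) :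
    Nat.card {x : R ⧸ maximalIdeal R ^ k //
      Ideal.quotientMap (maximalIdeal R ^ k) σ (maximalIdeal_pow_le_comap σ hσ k) x = x ∧ IsUnit x} = q ^ (k - 1) * (q - 1) := by
  classical
  haveI := CompleteLocalRing.finite_quotient_maximalIdeal_pow (R := R) k
  set σk := Ideal.quotientMap (maximalIdeal R ^ k) σ (maximalIdeal_pow_le_comap σ hσ k) with hσk
  have e2 : Nat.card {x : R ⧸ maximalIdeal R ^ k // σk x = x ∧ IsUnit x} + Nat.card {x : R ⧸ maximalIdeal R ^ k // σk x = x ∧ ¬ IsUnit x} =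
      Nat.card {x : R ⧸ maximalIdeal R ^ k // σk x = x} := by
    rw [← Nat.card_congr (Equiv.subtypeSubtypeEquivSubtypeInter (fun x : R ⧸ maximalIdeal R ^ k => σk x = x) (fun x => IsUnit x)),
      ← Nat.card_congr (Equiv.subtypeSubtypeEquivSubtypeInter (fun x : R ⧸ maximalIdeal R ^ k => σk x = x) (fun x => ¬ IsUnit x)),
      ← Nat.card_sum, Nat.card_congr (Equiv.sumCompl (fun x : {x : R ⧸ maximalIdeal R ^ k // σk x = x} => IsUnit x.1))]
  rw [natCard_fixed_nonunits_quotient_pow σ hσ ha hq hk, natCard_fixed_quotient_pow σ hσ ha hq k] at e2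
  obtain ⟨j, rfl⟩ := Nat.exists_eq_add_of_le' hk
  rw [Nat.add_sub_cancel] at e2 ⊢
  have h2 := two_le_q (R := R) hq
  have e : q ^ (j + 1) = q ^ j * (q - 1) + q ^ j := by
    rw [pow_succ, Nat.mul_sub_one, Nat.sub_add_cancel (Nat.le_mul_of_pos_right _ (by omega))]
  rw [e] at e2
  exact Nat.add_right_cancel e2

end Units

/-! ## §3 Prop. 7: the index of `R_E(j)^× = {u : σ u − u ∈ 𝔪^j}` in `R_E^×` -/

section Index

variable [IsDomain R] [IsDiscreteValuationRing R] (hσ : ∀ a, σ (σ a) = a)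

/-- MEMBERSHIP: a unit `u` of `R` lies in the preimage of the `σ̄_j`-fixed units of `R ⧸ 𝔪^j` iff `σ u − u ∈ 𝔪^j`, i.e. iff `u ∈ R^σ + 𝔪^j = R_E(j)`
(§1); so this preimage IS the unit group `R_E(j)^×` of Flicker's order, as a subgroup of `R_E^×`. [cite: Flicker1998UnitaryFL, Prop. 6–7 pp. 83–84] -/
theorem mem_comap_eqLocus_iff (j : ℕ) (u : Rˣ) :
    u ∈ ((Units.map (Ideal.quotientMap (maximalIdeal R ^ j) σ (maximalIdeal_pow_le_comap σ hσ j)).toMonoidHom).eqLocus (MonoidHom.id _)).comap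
        (Units.map (Ideal.Quotient.mk (maximalIdeal R ^ j)).toMonoidHom) ↔ σ (u : R) - u ∈ maximalIdeal R ^ j := by
  rw [Subgroup.mem_comap, ← Ideal.Quotient.eq, ← Ideal.quotientMap_mk (I := maximalIdeal R ^ j) (f := σ) (H := maximalIdeal_pow_le_comap σ hσ j)]
  constructor
  · intro h
    have := congrArg (fun w : (R ⧸ maximalIdeal R ^ j)ˣ => (w : R ⧸ maximalIdeal R ^ j)) h
    simpa only [Units.coe_map, RingHom.toMonoidHom_eq_coe, MonoidHom.coe_coe, MonoidHom.id_apply] using this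
  · intro h
    show Units.map _ (Units.map _ u) = Units.map _ u
    ext
    simpa only [Units.coe_map, RingHom.toMonoidHom_eq_coe, MonoidHom.coe_coe] using h

/-- `j = 0`: `R_E(0) = R_E`, the index is `1` (`𝔪^0 = R`, every unit qualifies). [cite: Flicker1998UnitaryFL, Prop. 7 p. 84] -/
theorem index_comap_eqLocus_zero :
    (((Units.map (Ideal.quotientMap (maximalIdeal R ^ 0) σ (maximalIdeal_pow_le_comap σ hσ 0)).toMonoidHom).eqLocus (MonoidHom.id _)).comap
        (Units.map (Ideal.Quotient.mk (maximalIdeal R ^ 0)).toMonoidHom)).index = 1 := by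
  rw [Subgroup.index_eq_one, eq_top_iff]
  intro u _
  rw [mem_comap_eqLocus_iff σ hσ 0 u, pow_zero, Ideal.one_eq_top]
  exact Submodule.mem_top

variable [Finite (ResidueField R)] {a : R} (ha : IsUnit (σ a - a)) {q : ℕ} (hq : Nat.card (ResidueField R) = q ^ 2)

include ha hq in
/-- **FLICKER'S PROP. 7 (unramified order index).**  For `j ≥ 1` the unit group `R_E(j)^× = {u ∈ R_E^× : σ u − u ∈ 𝔪^j}` of the order
`R_E(j) = R + π^j R_E` has index `[R_E^× : R_E(j)^×] = q^{j−1} (q + 1)` (`= (1 + q⁻¹) q^j`).  Proof: `R_E(j)^×` is the preimage of the `σ̄_j`-fixed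
units under the SURJECTION `R_E^× ↠ (R_E ⧸ 𝔪^j)ˣ`, so the index is `|(R_E ⧸ 𝔪^j)ˣ| ∕ |fixed units| = (q²)^{j−1}(q² − 1) ∕ (q^{j−1}(q − 1))`
(Flicker: the quotient of `[R_E^× : 1 + π^j R_E] = (q² − 1) q^{2(j−1)}` by `[R^× : 1 + π^j R] = (q − 1) q^{j−1}`).
[cite: Flicker1998UnitaryFL, Prop. 7 p. 84 and REMARK (Mars)] [cite: Serre1979, Ch. V §2 Prop. 3] -/
theorem index_comap_eqLocus_eq {j : ℕ} (hj : 1 ≤ j) :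
    (((Units.map (Ideal.quotientMap (maximalIdeal R ^ j) σ (maximalIdeal_pow_le_comap σ hσ j)).toMonoidHom).eqLocus (MonoidHom.id _)).comap
        (Units.map (Ideal.Quotient.mk (maximalIdeal R ^ j)).toMonoidHom)).index = q ^ (j - 1) * (q + 1) := by
  classical
  haveI := CompleteLocalRing.finite_quotient_maximalIdeal_pow (R := R) j
  set I := maximalIdeal R ^ j with hI
  set σj := Ideal.quotientMap I σ (maximalIdeal_pow_le_comap σ hσ j) with hσj
  set F : Subgroup (R ⧸ I)ˣ := (Units.map σj.toMonoidHom).eqLocus (MonoidHom.id _) with hF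
  rw [Subgroup.index_comap_of_surjective _ (units_map_mk_pow_surjective hj)]
  -- `|F| = |fixed units| = q^{j−1}(q−1)`
  have hFcard : Nat.card F = q ^ (j - 1) * (q - 1) := by
    rw [← natCard_fixed_units_quotient_pow σ hq hσ ha hj]
    refine Nat.card_eq_of_bijective (fun u => ⟨((u : (R ⧸ I)ˣ) : R ⧸ I), ⟨?_, (u : (R ⧸ I)ˣ).isUnit⟩⟩) ⟨fun u v h => ?_, fun x => ?_⟩
    · have := congrArg (fun w : (R ⧸ I)ˣ => (w : R ⧸ I)) (show Units.map σj.toMonoidHom (u : (R ⧸ I)ˣ) = u from u.2)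
      simpa only [Units.coe_map, RingHom.toMonoidHom_eq_coe, MonoidHom.coe_coe] using this
    · exact Subtype.ext (Units.ext (congrArg Subtype.val h))
    · refine ⟨⟨x.2.2.unit, ?_⟩, Subtype.ext x.2.2.unit_spec⟩
      show Units.map σj.toMonoidHom x.2.2.unit = x.2.2.unit
      ext; rw [Units.coe_map, x.2.2.unit_spec]; exact x.2.1
  -- `index · |F| = |units| = (q²)^{j−1}(q²−1)`
  have hmul := F.index_mul_card
  rw [hFcard, natCard_units_quotient_pow hq hj] at hmul
  have h2 := two_le_q' hq
  obtain ⟨i, rfl⟩ := Nat.exists_eq_add_of_le' hj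
  rw [Nat.add_sub_cancel] at hmul ⊢
  have hpos : 0 < q ^ i * (q - 1) := Nat.mul_pos (pow_pos (by omega) i) (by omega)
  have e : (q ^ 2) ^ i * (q ^ 2 - 1) = q ^ i * (q + 1) * (q ^ i * (q - 1)) := by
    have hsq : q ^ 2 - 1 = (q + 1) * (q - 1) := by
      rw [← Nat.sq_sub_sq, one_pow]
    rw [hsq, ← pow_mul, show 2 * i = i + i from two_mul i, pow_add]; ring
  rw [e] at hmul
  exact Nat.eq_of_mul_eq_mul_right hpos hmul
  where
  /-- `2 ≤ q` when `|𝓀| = q²`. -/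
  two_le_q' (hq : Nat.card (ResidueField R) = q ^ 2) : 2 ≤ q := by
    have h1 : 1 < Nat.card (ResidueField R) := Finite.one_lt_card_iff_nontrivial.2 inferInstance
    rw [hq] at h1
    by_contra hlt
    interval_cases q <;> simp at h1

include ha hq in
/-- Prop. 7 in the PRINTED shape: `[R_E^× : R_E(j)^×] = (1 + q⁻¹) q^j` for `j ≥ 1` (as a rational number; this is the weight `w(j)` of
[Flicker1998UnitaryFL, Cor. 9 p. 85]). [cite: Flicker1998UnitaryFL, Prop. 7 p. 84, Cor. 9 p. 85] -/
theorem index_comap_eqLocus_eq_rat {j : ℕ} (hj : 1 ≤ j) :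
    ((((Units.map (Ideal.quotientMap (maximalIdeal R ^ j) σ (maximalIdeal_pow_le_comap σ hσ j)).toMonoidHom).eqLocus (MonoidHom.id _)).comap
        (Units.map (Ideal.Quotient.mk (maximalIdeal R ^ j)).toMonoidHom)).index : ℚ) = (1 + (q : ℚ)⁻¹) * (q : ℚ) ^ j := by
  rw [index_comap_eqLocus_eq σ hσ ha hq hj]
  have h2 := index_comap_eqLocus_eq.two_le_q' (R := R) hq
  have hq0 : (q : ℚ) ≠ 0 := by exact_mod_cast (show q ≠ 0 by omega)
  obtain ⟨i, rfl⟩ := Nat.exists_eq_add_of_le' hj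
  rw [Nat.add_sub_cancel]
  push_cast
  field_simp
  ring

end Index

/-! ## §4 Prop. 8's printed value -/

/-- The arithmetic of [Flicker1998UnitaryFL, Prop. 8 p. 85]: `[P_H : P_H ∩ H^K_m] = [R_E^× : 1 + π^m R_E] · [R : π^{2m} R] = (q² − 1) q^{2(m−1)} · q^{2m}
= (1 − q⁻²) q^{4m}` for `m ≥ 1` (the two factors are `natCard_units_quotient_pow` and FILE 1's `|R ⧸ 𝔪^{2m}|`-type count `q^{2m}` for the
fixed ring). [cite: Flicker1998UnitaryFL, Prop. 8 pp. 84–85] -/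
theorem flicker_prop8_value {q : ℕ} (hq : 1 ≤ q) {m : ℕ} (hm : 1 ≤ m) :
    (((q ^ 2) ^ (m - 1) * (q ^ 2 - 1) * q ^ (2 * m) : ℕ) : ℚ) = (1 - ((q : ℚ) ^ 2)⁻¹) * (q : ℚ) ^ (4 * m) := by
  have hq0 : (q : ℚ) ≠ 0 := by exact_mod_cast (show q ≠ 0 by omega)
  have hq1 : 1 ≤ q ^ 2 := Nat.one_le_pow _ _ (by omega)
  obtain ⟨i, rfl⟩ := Nat.exists_eq_add_of_le' hm
  rw [Nat.add_sub_cancel]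
  push_cast [Nat.cast_sub hq1]
  field_simp
  ring

end Literature.NumberTheory.LocalFields.UnramifiedQuadraticNorm
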